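import Summits.RiemannHypothesis.RiemannHypothesis.Theorems.RuelleBandNribWeakRecurrenceToExact
import Summits.RiemannHypothesis.RiemannHypothesis.Theorems.RuelleBandAsymptoticCriticalLineSplit
import Summits.RiemannHypothesis.RiemannHypothesis.Theorems.RuelleBandLadderGlue
import Summits.RiemannHypothesis.RiemannHypothesis.Theorems.ExactFirstBand.Negative.Reformulations
import Literature.Barriers.RiemannHypothesis.BohrDenseValuesVoronin

/-!
# `NribWeakRecurrenceToExact` (stmt-RiemannHypothesis-18195, route `RuelleBand`): the split is LOSSLESS

Companion (`--supports stmt-RiemannHypothesis-18195`) of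
`Theorems/RuelleBandNribWeakRecurrenceToExact.lean`, which lands the glue
`NoRightInteriorBand → ZetaWeakRecurrence → ExactFirstBand`. Here the two CONVERSES, from results
already in the tree, so that the BC2-redirect split of thesis X is an EQUIVALENCE:

* `noRightInteriorBand_of_exactFirstBand` — `X → NoRightInteriorBand`, through the ladder
  `X → CofiniteCriticalLine → AsymptoticCriticalLine` (`ruelleBand_ladderGlue_proof`) and
  `noRightInteriorBand_of_asymptoticCriticalLine` (interior/edge split file);
* `zetaWeakRecurrence_of_riemannHypothesis`, `zetaWeakRecurrence_of_exactFirstBand` — `RH → WR`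
  (Bagchi/Voronin: under RH the returning shifts even have positive lower density, tree
  `riemannHypothesis_iff_strongRecurrence_of_Voronin` + `Voronin1975_universality_holds`, both
  proved) and `X ↔ RH` (`Negative.exactFirstBand_iff_riemannHypothesis`);
* `exactFirstBand_iff_noRightInteriorBand_and_weakRecurrence`,
  `riemannHypothesis_iff_noRightInteriorBand_and_weakRecurrence` — `X ↔ NRIB ∧ WR`, `RH ↔ NRIB ∧ WR`.

So refuting either child refutes RH, and neither child alone is known to be RH-equivalent.
-/

-- D-0017: single-problem summit; the lakefile turns this linter off for `Summits`; repeated here so that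
-- standalone elaboration is warning-free as well.
set_option linter.dupNamespace false

noncomputable section

namespace Summit.RiemannHypothesis.RiemannHypothesis.Theorems.NribWeakRecurrenceToExact

open Complex Set Metric Filter Topology
open Summit.RiemannHypothesis.RiemannHypothesis.Theses.RuelleBand (ExactFirstBand
  NoRightInteriorBand ZetaWeakRecurrence)
open Literature.Barriers.RiemannHypothesis (riemannHypothesis_iff_strongRecurrence_of_Voronin
  Voronin1975_universality_holds HasPosLowerDensity)
open Summit.RiemannHypothesis.RiemannHypothesis.Theorems.AsymptoticCriticalLine.InteriorEdgeSplit
  (noRightInteriorBand_of_asymptoticCriticalLine)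

/-- `X → NoRightInteriorBand`: down the ladder `X → CofiniteCriticalLine → AsymptoticCriticalLine`
(`ruelleBand_ladderGlue_proof`) and `ACL → NRIB` (radius `(σ₀ − 1/2)/2`,
`noRightInteriorBand_of_asymptoticCriticalLine`). [folklore] -/
theorem noRightInteriorBand_of_exactFirstBand (hX : ExactFirstBand) : NoRightInteriorBand := by
  have hL := Summit.RiemannHypothesis.RiemannHypothesis.Theorems.ruelleBand_ladderGlue_proof
  exact noRightInteriorBand_of_asymptoticCriticalLine (hL.2 (hL.1 hX))

/-- CALIBRATION `RH → WR`: under RH the shifts returning `ζ` within `ε` on a closed disc of the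
half-strip have positive lower density (Bagchi; tree `riemannHypothesis_iff_strongRecurrence_of_Voronin`
with the PROVED `Voronin1975_universality_holds`), in particular they are unbounded above.
[cite: Steuding2007, Thm. 8.3 and Thm. 1.7] [cite: Bagchi1987, main theorem] -/
theorem zetaWeakRecurrence_of_riemannHypothesis (h : RiemannHypothesis) : ZetaWeakRecurrence := by
  intro z r hr hrmin ε hε T
  have hz1 : 1 / 2 < z.re := by
    have := hrmin.trans_le (min_le_left _ _); linarith
  have hz2 : z.re < 1 := by
    have := hrmin.trans_le (min_le_right _ _); linarith
  have hpos : HasPosLowerDensity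
      {τ : ℝ | ∀ s ∈ closedBall z r, ‖riemannZeta (s + τ * I) - riemannZeta s‖ < ε} :=
    (riemannHypothesis_iff_strongRecurrence_of_Voronin Voronin1975_universality_holds).1 h ε hε z
      hz1 hz2 r hr hrmin
  obtain ⟨τ, hτ, hTτ⟩ := hpos.exists_gt T
  exact ⟨τ, hTτ.le, hτ⟩

/-- CALIBRATION `X → WR` (`X ↔ RH`, `Negative.exactFirstBand_iff_riemannHypothesis`).
[cite: Steuding2007, Thm. 8.3] -/
theorem zetaWeakRecurrence_of_exactFirstBand (hX : ExactFirstBand) : ZetaWeakRecurrence :=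
  zetaWeakRecurrence_of_riemannHypothesis
    (Summit.RiemannHypothesis.Cruxes.ExactFirstBand.Negative.exactFirstBand_iff_riemannHypothesis.1 hX)

/-- THE SPLIT IS LOSSLESS: `X ↔ NoRightInteriorBand ∧ ZetaWeakRecurrence`.
[cite: Steuding2007, Thm. 8.3] [cite: Bagchi1987, main theorem] -/
theorem exactFirstBand_iff_noRightInteriorBand_and_weakRecurrence :
    ExactFirstBand ↔ NoRightInteriorBand ∧ ZetaWeakRecurrence :=
  ⟨fun hX ↦ ⟨noRightInteriorBand_of_exactFirstBand hX, zetaWeakRecurrence_of_exactFirstBand hX⟩,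
    fun h ↦ exactFirstBand_of_noRightInteriorBand_of_weakRecurrence h.1 h.2⟩

/-- The same split read at the summit: `RH ↔ NoRightInteriorBand ∧ ZetaWeakRecurrence`.
[cite: Steuding2007, Thm. 8.3] [cite: Bagchi1987, main theorem] -/
theorem riemannHypothesis_iff_noRightInteriorBand_and_weakRecurrence :
    RiemannHypothesis ↔ NoRightInteriorBand ∧ ZetaWeakRecurrence :=
  Summit.RiemannHypothesis.Cruxes.ExactFirstBand.Negative.exactFirstBand_iff_riemannHypothesis.symm.trans
    exactFirstBand_iff_noRightInteriorBand_and_weakRecurrence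

end Summit.RiemannHypothesis.RiemannHypothesis.Theorems.NribWeakRecurrenceToExact

end
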